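import Summits.QuantumFields.BalabanUV.Beta.WilsonJetReflection
import Summits.QuantumFields.BalabanUV.Beta.WilsonJetReflect2Plaq
import Literature.MathematicalPhysics.QuantumFieldTheory.Balaban1983to89.Beta.PlaquetteVertex2
import Literature.MathematicalPhysics.QuantumFieldTheory.Balaban1983to89.Beta.WilsonWard22

/-!
# The `(2,2)`-jet of the Wilson plaquette sum UNDER AN AXIS REFLECTION in the product chart: THE JET LAW WITH CONTACT `jet22_pull`
# (β sub-cell, row BETA-an3, gen 31, node W-0W-S1 of the row owner's leaf (W-0W); one background order above `WilsonJetReflection.jet21_pull`)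

HONEST FRAMING (cell charter, verbatim): «discharging BetaPertH makes Balaban's UV stability UNCONDITIONAL — a real
constructive-QFT result; it is NOT the continuum limit and NOT the Clay problem.»  HONEST DEPENDENCY: continuum YM on T⁴ ⇐ BetaPertH ∧
nine spine estimates (0/9 proved); BetaPertH ⇐ (D1) ∧ (D4) ∧ CAP+tail; G-an2-4 gates asym, D1 and NE2/3/4.  DERIVED cell leaf: pure
non-commutative word algebra and finite lattice bookkeeping over an3's `WilsonVertex2` / `PlaquetteVertex2` (Literature, [folklore]
kernel algebra); no statement of Bałaban's papers is typed here, no `[cite:]` tag, no `def … : Prop`; the two `def`s (`reflDir₁`,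
`reflDir₂`) are lattice fields asserting nothing.  ABSOLUTE RULE of the cell honoured: nothing internally minted enters as a cited fact;
everything below is kernel-proved from the imports.  This file discharges NOTHING of `BetaPertH` and moves no wall statement.

## What is proved

Setting and notation of `Summits…Beta.WilsonJetReflection` (read its header: the site map `σ` of an axis reflection, involutive, with
`σ(x + e_κ) = σx + e_κ` (`κ ≠ α`), `σ(x + e_α) = σx − e_α`; the product-chart pull-back `pull σ e α X` (`−X(σx − e_α, α)` on `α`-bonds,
`X(σx, κ)` otherwise); the `α`-commutator letter `axComm W B α y = [B_α(y), W_α(y)]`).  THE RESULT (`jet22_pull`, §4), for every ring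
`𝔸`, every `𝕜`-linear TRACIAL `τ`, every finite lattice and every such `σ`, in the integer form (`×4`) of the Ward series:

  `4·jet22(pull W, pull B) = 4·jet22(W, B) + 4·[jet21(W + E₁, B) − jet21(W, B) − jet21(E₁, B)]`
  `                          + 2·[jet20(W + D) − jet20(W) − jet20(D)] + 4·jet20(E₁)`                                        (J₂)

(`PlaquetteVertex2.jet22`, `PlaquetteVertex.jet21 / jet20`), with the two CONTACT DIRECTION FIELDS supported on the `α`-bonds:
`E₁ = reflDir₁ W B α : (y, κ) ↦ [κ = α]·[B_α(y), W_α(y)]` and `D = reflDir₂ W B α : (y, κ) ↦ [κ = α]·[B_α(y), [B_α(y), W_α(y)]]` (§1).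
In words: the `(2,2)`-jet of the pulled-back fields is the original one plus the POLARISATION of the `(2,1)`-jet in the direction `E₁`,
plus the polarisation of the `(2,0)`-jet in the direction `½D`, plus the `(2,0)`-jet OF `E₁` — the bidegree-`(2,2)` component of
`F(pull W, pull B) = F(W + E₁ + ½D + O(B³)·W, B)` (dictionary in `WilsonJetReflect2Plaq`'s header; at order `(2,1)` the same expansion
gives `jet21_pull`, whose contact `2Σ τ(lcurl W·(Δ_ν axComm))` is `jet20(W + E₁) − jet20(W) − jet20(E₁)`).

* §1 `reflDir₁`, `reflDir₂` and their support (`…_of_ne`, `…_self`); the plaquette words of `W + E`, `E` off the axis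
  (`plaqWord_add_of_ne`, `plaqWord_of_ne`) and the vanishing of `quad∘wpart` on diagonal words (on W-free words: `WilsonWard22.P21_plaq_zero`,
  `quad_wpart_plaq_zero` BY NAME).
* §2 PER PLAQUETTE (`four_smul_trace_P22_plaqWord_pull_fst / snd`): for `p_{αν}(x)` / `p_{μα}(x)` the pulled-back word is the reflected
  reading of the first / second kind of the image plaquette `p_{να}(σx − e_α)` / `p_{αμ}(σx − e_α)` (`WilsonJetReflection`), so
  `WilsonJetReflect2Plaq.four_smul_trace_P22_plaq_reflect₁ / ₂` gives (J₂)'s density plaquette by plaquette.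
* §3 `sum_pull_bookkeeping`: the finite-lattice resummation behind every `jet…_pull` (split the ordered direction pairs at `α`, reindex
  the base points along the involutions `x ↦ σx − e_α` and `σ`), abstracted from `WilsonJetReflection.jet21_pull`'s proof.
* §4 `jet22_pull` (J₂).

Second reading (records, not an input): (J₂) and its per-plaquette densities were evaluated with `τ = tr` on random integer matrices in
exact arithmetic on the tori `(ℤ/3)², ℤ/4×ℤ/3, (ℤ/3)³` for every axis, `0` failures (`b2b-balaban-beta-an3/gen31/toy/p22toy.py`).

## What this file does NOT do

No coordinates / spin tables / bond stencils: the `(2,2)` analogue of `WilsonStencilReflection.quadratic_law` and of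
`WilsonReflectionContact.wilsonA_bref` — `wilsonW₂ d T κ (bref α κ u) κ′ (bref α κ′ u′)` versus `refK (Φ N α) (wilsonW₂ d T κ u κ′ u′ + contact)`
— is the NEXT node (W-0W-S2/S3) and is not claimed here; nothing at order `B³`; no estimate; not summit progress, not the continuum limit,
not Clay.  [folklore] throughout.
-/

namespace Summit.QuantumFields.BalabanUV.Beta.WilsonJetReflection2

open Literature.MathematicalPhysics.QuantumFieldTheory.Balaban1983to89.Beta.TransportVertices (quad commSum commSum_four two_smul_quad)
open Literature.MathematicalPhysics.QuantumFieldTheory.Balaban1983to89.Beta.WilsonVertex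
open Literature.MathematicalPhysics.QuantumFieldTheory.Balaban1983to89.Beta.WilsonVertex2 (P22)
open Literature.MathematicalPhysics.QuantumFieldTheory.Balaban1983to89.Beta.PlaquetteVertex
  (plaqWord jet21 jet20 trace_P21_plaqWord_self)
open Literature.MathematicalPhysics.QuantumFieldTheory.Balaban1983to89.Beta.PlaquetteVertex2 (jet22 P22_plaqWord_self)
open Literature.MathematicalPhysics.QuantumFieldTheory.Balaban1983to89.Beta.WilsonWard22 (P21_plaq_zero quad_wpart_plaq_zero)
open Summit.QuantumFields.BalabanUV.Beta.WilsonJetReflection (pull axComm plaqWord_pull_of_ne sum_sum_split sum_invol)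
open Summit.QuantumFields.BalabanUV.Beta.WilsonJetReflect2Plaq (four_smul_trace_P22_plaq_reflect₁ four_smul_trace_P22_plaq_reflect₂)

variable (𝕜 : Type*) [RCLike 𝕜] {𝔸 : Type*} [NormedRing 𝔸] [NormedAlgebra 𝕜 𝔸]
variable {V : Type*} [AddCommGroup V] [Module 𝕜 V]
variable {Λ : Type*} [Fintype Λ] [AddCommGroup Λ] {D : Type*} [Fintype D] [DecidableEq D]

/-! ## §1 The two contact direction fields and the words they enter -/

/-- THE FIRST CONTACT DIRECTION `E₁ = reflDir₁ W B α`: the commutator letter `[B_α(y), W_α(y)]` on the `α`-bonds, zero on the others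
(the first-order term of `−Ad(e^{−B})` acting on the reflected fluctuation).  A definition asserting nothing. [folklore] -/
def reflDir₁ (W B : Λ → D → 𝔸) (α : D) : Λ → D → 𝔸 := fun y κ => if κ = α then axComm W B α y else 0

/-- THE SECOND CONTACT DIRECTION `D = reflDir₂ W B α`: the double commutator `[B_α(y), [B_α(y), W_α(y)]]` on the `α`-bonds, zero on the
others (TWICE the second-order term of `Ad(e^{−B})`).  A definition asserting nothing. [folklore] -/
def reflDir₂ (W B : Λ → D → 𝔸) (α : D) : Λ → D → 𝔸 :=
  fun y κ => if κ = α then B y α * axComm W B α y - axComm W B α y * B y α else 0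

variable {e : D → Λ} {α : D}

omit [Fintype Λ] [AddCommGroup Λ] [Fintype D] in
/-- `E₁` vanishes off the `α`-bonds. [folklore] -/
theorem reflDir₁_of_ne (W B : Λ → D → 𝔸) (y : Λ) {κ : D} (hκ : κ ≠ α) : reflDir₁ W B α y κ = 0 := if_neg hκ

omit [Fintype Λ] [AddCommGroup Λ] [Fintype D] in
/-- `D` vanishes off the `α`-bonds. [folklore] -/
theorem reflDir₂_of_ne (W B : Λ → D → 𝔸) (y : Λ) {κ : D} (hκ : κ ≠ α) : reflDir₂ W B α y κ = 0 := if_neg hκ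

omit [Fintype Λ] [AddCommGroup Λ] [Fintype D] in
/-- `E₁` on an `α`-bond. [folklore] -/
theorem reflDir₁_self (W B : Λ → D → 𝔸) (y : Λ) : reflDir₁ W B α y α = B y α * W y α - W y α * B y α := if_pos rfl

omit [Fintype Λ] [AddCommGroup Λ] [Fintype D] in
/-- `D` on an `α`-bond. [folklore] -/
theorem reflDir₂_self (W B : Λ → D → 𝔸) (y : Λ) :
    reflDir₂ W B α y α = B y α * (B y α * W y α - W y α * B y α) - (B y α * W y α - W y α * B y α) * B y α := if_pos rfl

omit [Fintype Λ] [Fintype D] [DecidableEq D] in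
/-- a field supported on the `α`-bonds does not change the words of the plaquettes NOT containing `α`. [folklore] -/
theorem plaqWord_add_of_ne (W B E : Λ → D → 𝔸) (hE : ∀ y κ, κ ≠ α → E y κ = 0) (y : Λ) {μ ν : D} (hμ : μ ≠ α) (hν : ν ≠ α) :
    plaqWord e (W + E) B y μ ν = plaqWord e W B y μ ν := by
  simp only [plaqWord, Pi.add_apply, hE _ _ hμ, hE _ _ hν, add_zero]

omit [Fintype Λ] [Fintype D] [DecidableEq D] in
/-- … and its own words there are W-free. [folklore] -/
theorem plaqWord_of_ne (B E : Λ → D → 𝔸) (hE : ∀ y κ, κ ≠ α → E y κ = 0) (y : Λ) {μ ν : D} (hμ : μ ≠ α) (hν : ν ≠ α) :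
    plaqWord e E B y μ ν = plaq 0 0 0 0 (B y μ) (B (y + e μ) ν) (B (y + e ν) μ) (B y ν) := by
  simp only [plaqWord, hE _ _ hμ, hE _ _ hν]

omit [Fintype Λ] [Fintype D] [DecidableEq D] in
/-- a DIAGONAL word `p_{μμ}(y)` has no `(2,0)`-component: its W-letters `(a, c, −c, −a)` sum to zero and their ordered commutator sum
vanishes. [folklore] -/
theorem quad_wpart_plaqWord_self (X B : Λ → D → 𝔸) (y : Λ) (μ : D) : quad 𝕜 (wpart (plaqWord e X B y μ μ)) = 0 := by
  have h : (2 : 𝕜) • quad 𝕜 (wpart (plaqWord e X B y μ μ)) = 0 := by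
    rw [two_smul_quad, plaqWord, wpart_plaq, sum_four_signed, commSum_four]
    noncomm_ring
  have h2 := congrArg (fun v => (2 : 𝕜)⁻¹ • v) h
  simp only [smul_smul, inv_mul_cancel₀ (two_ne_zero' 𝕜), one_smul, smul_zero] at h2
  exact h2

/-! ## §2 Per plaquette: the pulled-back `(2,2)`-density is the image plaquette's plus the contact densities -/

variable {σ : Λ → Λ}

omit [Fintype Λ] [Fintype D] in
/-- plaquettes `p_{αν}(x)`, `ν ≠ α` (image plaquette `p_{να}(y)`, `y = σx − e_α`; reflected reading of the FIRST kind):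
`4τP22(pulled word) = 4τP22(p) + 4[τP21(p; W+E₁) − τP21(p; W) − τP21(p; E₁)] + 2[τq(p; W+D) − τq(p; W) − τq(p; D)] + 4τq(p; E₁)`
(`q = quad∘wpart`, all at the image plaquette). [folklore] -/
theorem four_smul_trace_P22_plaqWord_pull_fst (τ : 𝔸 →ₗ[𝕜] V) (hτ : ∀ a b : 𝔸, τ (a * b) = τ (b * a))
    (h₁ : ∀ x κ, κ ≠ α → σ (x + e κ) = σ x + e κ) (h₂ : ∀ x, σ (x + e α) = σ x - e α) (W B : Λ → D → 𝔸) (x : Λ)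
    {ν : D} (hν : ν ≠ α) :
    (4 : 𝕜) • τ (P22 𝕜 (plaqWord e (pull σ e α W) (pull σ e α B) x α ν)) =
      (4 : 𝕜) • τ (P22 𝕜 (plaqWord e W B (σ x - e α) ν α))
        + ((4 : 𝕜) • τ (P21 𝕜 (plaqWord e (W + reflDir₁ W B α) B (σ x - e α) ν α))
            - (4 : 𝕜) • τ (P21 𝕜 (plaqWord e W B (σ x - e α) ν α))
            - (4 : 𝕜) • τ (P21 𝕜 (plaqWord e (reflDir₁ W B α) B (σ x - e α) ν α)))
        + ((2 : 𝕜) • τ (quad 𝕜 (wpart (plaqWord e (W + reflDir₂ W B α) B (σ x - e α) ν α)))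
            - (2 : 𝕜) • τ (quad 𝕜 (wpart (plaqWord e W B (σ x - e α) ν α)))
            - (2 : 𝕜) • τ (quad 𝕜 (wpart (plaqWord e (reflDir₂ W B α) B (σ x - e α) ν α))))
        + (4 : 𝕜) • τ (quad 𝕜 (wpart (plaqWord e (reflDir₁ W B α) B (σ x - e α) ν α))) := by
  have hxν : σ (x + e ν) - e α = σ x - e α + e ν := by rw [h₁ _ _ hν]; abel
  have e1 : plaqWord e (pull σ e α W) (pull σ e α B) x α ν =
      plaq (-W (σ x - e α) α) (W (σ x - e α) ν) (-W (σ x - e α + e ν) α) (W (σ x) ν)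
        (-B (σ x - e α) α) (B (σ x - e α) ν) (-B (σ x - e α + e ν) α) (B (σ x) ν) := by
    simp only [plaqWord, pull, if_neg hν, if_true, h₂, hxν]
  rw [e1]
  simp only [plaqWord, Pi.add_apply, reflDir₁_of_ne W B _ hν, reflDir₂_of_ne W B _ hν, reflDir₁_self, reflDir₂_self, add_zero,
    sub_add_cancel]
  exact four_smul_trace_P22_plaq_reflect₁ 𝕜 τ (W (σ x - e α) ν) (W (σ x - e α + e ν) α) (W (σ x) ν) (W (σ x - e α) α)
    (B (σ x - e α) ν) (B (σ x - e α + e ν) α) (B (σ x) ν) (B (σ x - e α) α) hτ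

omit [Fintype Λ] [Fintype D] in
/-- plaquettes `p_{μα}(x)`, `μ ≠ α` (image plaquette `p_{αμ}(y)`, `y = σx − e_α`; reflected reading of the SECOND kind): the same law.
[folklore] -/
theorem four_smul_trace_P22_plaqWord_pull_snd (τ : 𝔸 →ₗ[𝕜] V) (hτ : ∀ a b : 𝔸, τ (a * b) = τ (b * a))
    (h₁ : ∀ x κ, κ ≠ α → σ (x + e κ) = σ x + e κ) (h₂ : ∀ x, σ (x + e α) = σ x - e α) (W B : Λ → D → 𝔸) (x : Λ)
    {μ : D} (hμ : μ ≠ α) :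
    (4 : 𝕜) • τ (P22 𝕜 (plaqWord e (pull σ e α W) (pull σ e α B) x μ α)) =
      (4 : 𝕜) • τ (P22 𝕜 (plaqWord e W B (σ x - e α) α μ))
        + ((4 : 𝕜) • τ (P21 𝕜 (plaqWord e (W + reflDir₁ W B α) B (σ x - e α) α μ))
            - (4 : 𝕜) • τ (P21 𝕜 (plaqWord e W B (σ x - e α) α μ))
            - (4 : 𝕜) • τ (P21 𝕜 (plaqWord e (reflDir₁ W B α) B (σ x - e α) α μ)))
        + ((2 : 𝕜) • τ (quad 𝕜 (wpart (plaqWord e (W + reflDir₂ W B α) B (σ x - e α) α μ)))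
            - (2 : 𝕜) • τ (quad 𝕜 (wpart (plaqWord e W B (σ x - e α) α μ)))
            - (2 : 𝕜) • τ (quad 𝕜 (wpart (plaqWord e (reflDir₂ W B α) B (σ x - e α) α μ))))
        + (4 : 𝕜) • τ (quad 𝕜 (wpart (plaqWord e (reflDir₁ W B α) B (σ x - e α) α μ))) := by
  have hxμ : σ (x + e μ) - e α = σ x - e α + e μ := by rw [h₁ _ _ hμ]; abel
  have e1 : plaqWord e (pull σ e α W) (pull σ e α B) x μ α =
      plaq (W (σ x) μ) (-W (σ x - e α + e μ) α) (W (σ x - e α) μ) (-W (σ x - e α) α)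
        (B (σ x) μ) (-B (σ x - e α + e μ) α) (B (σ x - e α) μ) (-B (σ x - e α) α) := by
    simp only [plaqWord, pull, if_neg hμ, if_true, h₂, hxμ]
  rw [e1]
  simp only [plaqWord, Pi.add_apply, reflDir₁_of_ne W B _ hμ, reflDir₂_of_ne W B _ hμ, reflDir₁_self, reflDir₂_self, add_zero,
    sub_add_cancel]
  exact four_smul_trace_P22_plaq_reflect₂ 𝕜 τ (W (σ x - e α) α) (W (σ x) μ) (W (σ x - e α + e μ) α) (W (σ x - e α) μ)
    (B (σ x - e α) α) (B (σ x) μ) (B (σ x - e α + e μ) α) (B (σ x - e α) μ) hτ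

/-! ## §3 The resummation over the lattice -/

omit [AddCommGroup Λ] [DecidableEq D] in
/-- **REFLECTION BOOKKEEPING.**  If a density `f` of the pulled-back fields is read, plaquette by plaquette, as a density `g` of the
original fields at the image plaquette — `p_{αν}(x) ↦ p_{να}(bx)`, `p_{μα}(x) ↦ p_{αμ}(bx)`, `p_{μν}(x) ↦ p_{μν}(σx)` off the axis, both
vanishing on diagonal words — and `b`, `σ` are involutions of the finite site set, then the lattice sums of `f` and `g` over all sites
and ordered direction pairs agree. [folklore] -/
theorem sum_pull_bookkeeping [DecidableEq D] {b : Λ → Λ} (hσ : Function.Involutive σ) (hb : Function.Involutive b) (α : D)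
    (f g : Λ → D → D → V) (hf0 : ∀ x, f x α α = 0) (hg0 : ∀ y, g y α α = 0)
    (hf1 : ∀ x ν, ν ≠ α → f x α ν = g (b x) ν α) (hf2 : ∀ x μ, μ ≠ α → f x μ α = g (b x) α μ)
    (hf3 : ∀ x μ ν, μ ≠ α → ν ≠ α → f x μ ν = g (σ x) μ ν) :
    ∑ x, ∑ μ, ∑ ν, f x μ ν = ∑ y, ∑ μ, ∑ ν, g y μ ν := by
  set A₁ : Λ → V := fun y => ∑ ν ∈ Finset.univ.erase α, g y α ν with hA₁
  set A₂ : Λ → V := fun y => ∑ μ ∈ Finset.univ.erase α, g y μ α with hA₂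
  set R : Λ → V := fun y => ∑ μ ∈ Finset.univ.erase α, ∑ ν ∈ Finset.univ.erase α, g y μ ν with hR
  have key : ∀ x, ∑ μ, ∑ ν, f x μ ν = A₂ (b x) + A₁ (b x) + R (σ x) := by
    intro x
    rw [sum_sum_split _ α, hf0, zero_add]
    have g1 : ∑ ν ∈ Finset.univ.erase α, f x α ν = A₂ (b x) :=
      Finset.sum_congr rfl fun ν hν => hf1 x ν (Finset.ne_of_mem_erase hν)
    have g2 : ∑ μ ∈ Finset.univ.erase α, f x μ α = A₁ (b x) :=
      Finset.sum_congr rfl fun μ hμ => hf2 x μ (Finset.ne_of_mem_erase hμ)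
    have g3 : ∑ μ ∈ Finset.univ.erase α, ∑ ν ∈ Finset.univ.erase α, f x μ ν = R (σ x) :=
      Finset.sum_congr rfl fun μ hμ => Finset.sum_congr rfl fun ν hν =>
        hf3 x μ ν (Finset.ne_of_mem_erase hμ) (Finset.ne_of_mem_erase hν)
    rw [g1, g2, g3]
  have key0 : ∀ y, ∑ μ, ∑ ν, g y μ ν = A₁ y + A₂ y + R y := by
    intro y
    rw [sum_sum_split _ α, hg0, zero_add]
  rw [Finset.sum_congr rfl fun x _ => key x, Finset.sum_congr rfl fun y _ => key0 y]
  simp only [Finset.sum_add_distrib]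
  rw [sum_invol hb A₂, sum_invol hb A₁, sum_invol hσ R]
  abel

/-! ## §4 The jet law -/

/-- **THE `(2,2)`-JET LAW UNDER AN AXIS REFLECTION (J₂).**  For a site involution `σ` shifting the frame as an axis reflection does
(`σ(x + e_κ) = σx + e_κ` for `κ ≠ α`, `σ(x + e_α) = σx − e_α`), every ring, every tracial `𝕜`-linear `τ`, all fields `W, B`:
`4·jet22(pull W, pull B) = 4·jet22(W,B) + 4·[jet21(W + E₁, B) − jet21(W, B) − jet21(E₁, B)] + 2·[jet20(W + D) − jet20(W) − jet20(D)]
+ 4·jet20(E₁)`, `E₁ = reflDir₁ W B α`, `D = reflDir₂ W B α`.  (`jet20` ignores its background argument; it is carried as `B`.) [folklore] -/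
theorem jet22_pull (τ : 𝔸 →ₗ[𝕜] V) (hτ : ∀ a b : 𝔸, τ (a * b) = τ (b * a)) (hσ : Function.Involutive σ)
    (h₁ : ∀ x κ, κ ≠ α → σ (x + e κ) = σ x + e κ) (h₂ : ∀ x, σ (x + e α) = σ x - e α) (W B : Λ → D → 𝔸) :
    (4 : 𝕜) • jet22 𝕜 τ e (pull σ e α W) (pull σ e α B) =
      (4 : 𝕜) • jet22 𝕜 τ e W B
        + ((4 : 𝕜) • jet21 𝕜 τ e (W + reflDir₁ W B α) B - (4 : 𝕜) • jet21 𝕜 τ e W B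
            - (4 : 𝕜) • jet21 𝕜 τ e (reflDir₁ W B α) B)
        + ((2 : 𝕜) • jet20 𝕜 τ e (W + reflDir₂ W B α) B - (2 : 𝕜) • jet20 𝕜 τ e W B
            - (2 : 𝕜) • jet20 𝕜 τ e (reflDir₂ W B α) B)
        + (4 : 𝕜) • jet20 𝕜 τ e (reflDir₁ W B α) B := by
  have h₂' : ∀ z, σ (z - e α) = σ z + e α := fun z => by
    have h := h₂ (z - e α)
    rw [sub_add_cancel] at h
    rw [h]; abel
  have hbi : Function.Involutive (fun x => σ x - e α) := fun x => by
    show σ (σ x - e α) - e α = x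
    rw [h₂', hσ x]; abel
  -- the original density, plaquette by plaquette
  set g : Λ → D → D → V := fun y μ ν =>
    (4 : 𝕜) • τ (P22 𝕜 (plaqWord e W B y μ ν))
      + ((4 : 𝕜) • τ (P21 𝕜 (plaqWord e (W + reflDir₁ W B α) B y μ ν)) - (4 : 𝕜) • τ (P21 𝕜 (plaqWord e W B y μ ν))
          - (4 : 𝕜) • τ (P21 𝕜 (plaqWord e (reflDir₁ W B α) B y μ ν)))
      + ((2 : 𝕜) • τ (quad 𝕜 (wpart (plaqWord e (W + reflDir₂ W B α) B y μ ν)))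
          - (2 : 𝕜) • τ (quad 𝕜 (wpart (plaqWord e W B y μ ν)))
          - (2 : 𝕜) • τ (quad 𝕜 (wpart (plaqWord e (reflDir₂ W B α) B y μ ν))))
      + (4 : 𝕜) • τ (quad 𝕜 (wpart (plaqWord e (reflDir₁ W B α) B y μ ν))) with hg
  have L : (4 : 𝕜) • jet22 𝕜 τ e (pull σ e α W) (pull σ e α B) =
      ∑ x, ∑ μ, ∑ ν, (4 : 𝕜) • τ (P22 𝕜 (plaqWord e (pull σ e α W) (pull σ e α B) x μ ν)) := by
    simp only [jet22, Finset.smul_sum]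
  have R : (4 : 𝕜) • jet22 𝕜 τ e W B
        + ((4 : 𝕜) • jet21 𝕜 τ e (W + reflDir₁ W B α) B - (4 : 𝕜) • jet21 𝕜 τ e W B
            - (4 : 𝕜) • jet21 𝕜 τ e (reflDir₁ W B α) B)
        + ((2 : 𝕜) • jet20 𝕜 τ e (W + reflDir₂ W B α) B - (2 : 𝕜) • jet20 𝕜 τ e W B
            - (2 : 𝕜) • jet20 𝕜 τ e (reflDir₂ W B α) B)
        + (4 : 𝕜) • jet20 𝕜 τ e (reflDir₁ W B α) B = ∑ y, ∑ μ, ∑ ν, g y μ ν := by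
    simp only [hg, jet22, jet21, jet20, Finset.smul_sum, ← Finset.sum_sub_distrib, ← Finset.sum_add_distrib]
  rw [L, R]
  refine sum_pull_bookkeeping hσ hbi α _ g ?_ ?_ ?_ ?_ ?_
  · intro x
    rw [P22_plaqWord_self, map_zero, smul_zero]
  · intro y
    simp only [hg, P22_plaqWord_self, trace_P21_plaqWord_self 𝕜 τ hτ, quad_wpart_plaqWord_self, map_zero, smul_zero, sub_self,
      add_zero]
  · intro x ν hν
    simp only [hg]
    exact four_smul_trace_P22_plaqWord_pull_fst 𝕜 τ hτ h₁ h₂ W B x hν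
  · intro x μ hμ
    simp only [hg]
    exact four_smul_trace_P22_plaqWord_pull_snd 𝕜 τ hτ h₁ h₂ W B x hμ
  · intro x μ ν hμ hν
    simp only [hg, plaqWord_pull_of_ne h₁ W B x hμ hν,
      plaqWord_add_of_ne W B (reflDir₁ W B α) (fun y κ hκ => reflDir₁_of_ne W B y hκ) (σ x) hμ hν,
      plaqWord_add_of_ne W B (reflDir₂ W B α) (fun y κ hκ => reflDir₂_of_ne W B y hκ) (σ x) hμ hν,
      plaqWord_of_ne B (reflDir₁ W B α) (fun y κ hκ => reflDir₁_of_ne W B y hκ) (σ x) hμ hν,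
      plaqWord_of_ne B (reflDir₂ W B α) (fun y κ hκ => reflDir₂_of_ne W B y hκ) (σ x) hμ hν,
      P21_plaq_zero, quad_wpart_plaq_zero, map_zero, smul_zero, sub_self, add_zero]

end Summit.QuantumFields.BalabanUV.Beta.WilsonJetReflection2
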